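import Summits.HodgeConjecture.HodgeConjecture.Theses.NikulinTwinTransport
import Literature.AlgebraicGeometry.Surfaces.K3Marking
import Literature.AlgebraicGeometry.Surfaces.K3SurfaceProofs
import HarnessLib

/-!
# Route NikulinTwinTransport · crux X = `TwinSimilitudeAlgebraic` (stmt-HodgeConjecture-13674) —
# objects of the line `hyperkaehler-nikulin-anchors` (K3 side)

Definitions (no stub statements, no named facts) used by the positive-side files of this crux for the
line `hyperkaehler-nikulin-anchors`, i.e. by the registered stubs of the checked skeleton
`Cruxes/TwinSimilitudeAlgebraic/Lines/hyperkaehler_nikulin_anchors.lean` (crux-plan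
planner-cruxplan-stmt-HodgeConjecture-13674-hyperkaehler-nikulin-0; leads prover-line-stmt-HodgeConjecture-13674-0
and -c1-0) and by its composition theorem `TwinSimilitudeAlgebraic_of`.  Statements are VERBATIM those of
the planner's checked skeleton (sections "The host lattice and the sector" and "Partial twin classes");
they are moved here so that stub files under `Theorems/` can import them (a `Theorems` file may not
import a `Cruxes` work file), exactly as `Theorems/NikulinTwinTransportTwinTwistorTransportMukaiLiftDefs.lean`
does for the sibling crux 14393:

* the HOST LATTICE `N = U³ ⊕ E₈(−2) ⊕ ⟨−2⟩` (Mongardi 2012 Thm. 5.2: the invariant lattice of a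
  symplectic involution on a `K3^{[2]}`-type fourfold): `HostIndex`, `hostGram`, `hostFormRat`;
* the rational Néron–Severi / transcendental spaces of a K3 period `x ∈ Λ_ℂ`: `castVec`, `nsRat x`,
  `trRat x` (Huybrechts Ch. 3);
* the HK-NIKULIN SECTOR `InHKNikulinSector S` (`T(S)_ℚ ↪ N_ℚ` isometrically, for some marking);
* PARTIAL ALGEBRAIC TWIN CLASSES `IsPartialTwinClass μ S Sg hS hSg p pg γ` (the output of the line's
  hyperkähler heart: `[γ]_*` rational, type-preserving, `T(S) ↠ T(Sg)`, doubling the cup form on `T(S)`).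

Sources: G. Mongardi, Cent. Eur. J. Math. 10 (2012) Thm. 5.2; M. Varesco, Math. Z. 305 (2023) Prop. 2.5;
C. Camere, A. Garbagnati, G. Kapustka, M. Kapustka, arXiv:2607.00130 Thm. 5.12; E. Markman, Compos.
Math. 160 (2024) Thm. 1.1; D. Huybrechts, *Lectures on K3 Surfaces*, Ch. 3.
-/

-- `Summit.HodgeConjecture.HodgeConjecture.…` (summit = problem) duplicates a namespace component by design (D-0017).
set_option linter.dupNamespace false

noncomputable section

open CategoryTheory MonoidalCategory
open scoped Matrix
open Literature.AlgebraicGeometry.Motives Literature.AlgebraicGeometry.HodgeTheory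
open Literature.AlgebraicGeometry.Surfaces
open Literature.AlgebraicTopology.SingularHomology

namespace Summit.HodgeConjecture.HodgeConjecture.Theorems.NikulinTwinTransport

/-! ## Local notations (verbatim those of the route's Theorems files) -/

/-- `MarkedK3[S, η, p, x]`: a marked K3 surface with period `x` — the six marking clauses of the named
facts `Huybrechts_K3_marking_exists` / `Huybrechts_K3_periodSurjective_projective`. Local notation only,
verbatim from `NikulinTwinTransportHodgeSimilitudeAlgebraicAnchors`. -/
local notation3 (prettyPrint := false) "MarkedK3[" S ", " η ", " p ", " x "]" =>
  (IsIntegralClass p ∧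
    (∀ q : complexBetti S (2 * 2), IsIntegralClass q → ∃ n : ℤ, q = n • p) ∧
    (∀ c : complexBetti S (2 * 1), IsIntegralClass c ↔ ∃ v : K3Index → ℤ, η c = fun i => (v i : ℂ)) ∧
    (∀ a b : complexBetti S (2 * 1),
        cupProduct (rfl : 2 * 1 + 2 * 1 = 2 * 2) a b = k3Form (η a) (η b) • p) ∧
    IsOfHodgeType 2 S (2 * 1) 2 0 (LinearEquiv.symm η x) ∧
    (∀ τ : complexBetti S (2 * 1), IsOfHodgeType 2 S (2 * 1) 2 0 τ → ∃ t : ℂ, τ = t • LinearEquiv.symm η x))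

/-- `Corr[μ, S, S', hS, hS' ; γ, y] = [γ]_* y = fst_*(snd^* y ∪ γ)`, the action of
`γ ∈ H⁴((S ⊗ S′)(ℂ); ℂ)` as a correspondence `H²(S′) → H²(S)` (the FIRST factor receives). Local notation
only, verbatim from the route's Theorems files; for `hS hS'` the K3 witnesses it is definitionally the
inline term of the route items. -/
local notation3 (prettyPrint := false) "Corr[" μ ", " S ", " S' ", " hS ", " hS' " ; " γ ", " y "]" =>
  complexGysin μ
    (IsSmoothProjective.tensor_holds (IsK3Surface.isSmoothProjective hS)
      (IsK3Surface.isSmoothProjective hS'))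
    (IsK3Surface.isSmoothProjective hS) (SemiCartesianMonoidalCategory.fst S S')
    (rfl : 2 * 1 + 2 * 2 + 2 * 2 = 2 * 1 + 2 * (2 + 2))
    (cupProduct (rfl : 2 * 1 + 2 * 2 = 2 * 1 + 2 * 2)
      (complexBetti.map (SemiCartesianMonoidalCategory.snd S S') (2 * 1) y) γ)

/-! ## The host lattice `N = U³ ⊕ E₈(−2) ⊕ ⟨−2⟩` and the sector -/

/-- Index of a basis of the HOST LATTICE `N = U³ ⊕ E₈(−2) ⊕ ⟨−2⟩` (rank `15`, signature `(3,12)`): the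
invariant lattice of a symplectic involution on a manifold of `K3^{[2]}`-type (Mongardi, Thm 5.2) — one
rank more than Varesco's host `U³ ⊕ E₈(−2)` of the Nikulin locus (the extra `⟨−2⟩` is the Hilbert–Chow
class `δ`, transcendental on the general `(X, φ)`, CGKK p. 21). [cite: Mongardi2011, Thm. 5.2]
[cite: Varesco2023, Prop. 2.5] -/
abbrev HostIndex : Type := (Fin 2 ⊕ (Fin 2 ⊕ Fin 2)) ⊕ (Fin 8 ⊕ Fin 1)

/-- Gram matrix of `N = U³ ⊕ E₈(−2) ⊕ ⟨−2⟩`: blocks `U, U, U`, `−2·E₈` (Mathlib's Cartan matrix = Gram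
matrix of the `E₈` root lattice), `(−2)`. [cite: Mongardi2011, Thm. 5.2] -/
def hostGram : Matrix HostIndex HostIndex ℤ :=
  Matrix.fromBlocks
    (Matrix.fromBlocks hyperbolicPlaneGram 0 0
      (Matrix.fromBlocks hyperbolicPlaneGram 0 0 hyperbolicPlaneGram))
    0 0
    (Matrix.fromBlocks (-(2 • CartanMatrix.E₈)) 0 0 (-(2 • (1 : Matrix (Fin 1) (Fin 1) ℤ))))

/-- The host Gram matrix is symmetric (kernel-checked). [folklore] -/
theorem hostGram_transpose : hostGram.transpose = hostGram := by
  decide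

/-- The rational host form on `N_ℚ = ℚ¹⁵`. [cite: Mongardi2011, Thm. 5.2] -/
def hostFormRat : LinearMap.BilinForm ℚ (HostIndex → ℚ) :=
  Matrix.toBilin' (hostGram.map (Int.cast : ℤ → ℚ))

/-- `Λ_ℚ ⊂ Λ_ℂ`: the coordinatewise cast `ℚ²² → ℂ²²` as a `ℚ`-linear map. [folklore] -/
def castVec : (K3Index → ℚ) →ₗ[ℚ] (K3Index → ℂ) :=
  LinearMap.pi fun i => (Algebra.linearMap ℚ ℂ) ∘ₗ LinearMap.proj i

/-- Unfolding of `castVec`. [folklore] -/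
theorem castVec_apply (v : K3Index → ℚ) : castVec v = fun i => (v i : ℂ) := by
  funext i
  simp [castVec, Algebra.linearMap_apply]

/-- The RATIONAL NÉRON–SEVERI SPACE of a period `x ∈ Λ_ℂ`: the rational lattice vectors orthogonal to `x`
(for rational `v`, `(v.x) = 0 ⟺ (v.x̄) = 0 ⟺ v` is of type `(1,1)`; under a marking of a projective K3
with period `x` this is `NS(S)_ℚ`, by Lefschetz `(1,1)`). [cite: Huybrechts2016K3, Ch. 1 §3.3 and Ch. 3 §2] -/
def nsRat (x : K3Index → ℂ) : Submodule ℚ (K3Index → ℚ) :=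
  LinearMap.ker (((k3FormC.flip x).restrictScalars ℚ) ∘ₗ castVec)

/-- Membership in `nsRat x`: `(v.x) = 0`. [folklore] -/
theorem mem_nsRat {x : K3Index → ℂ} {v : K3Index → ℚ} :
    v ∈ nsRat x ↔ k3Form (fun i => (v i : ℂ)) x = 0 := by
  simp [nsRat, castVec_apply, k3FormC_apply]

/-- The RATIONAL TRANSCENDENTAL SPACE of a period `x`: the `k3FormRat`-orthogonal of `nsRat x` in `Λ_ℚ`
(under a marking: `T(S)_ℚ = NS(S)_ℚ^⊥`, the smallest rational sub-Hodge structure containing `H^{2,0}`).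
[cite: Huybrechts2016K3, Ch. 3 Def. 2.5 and Lemma 3.1] -/
def trRat (x : K3Index → ℂ) : Submodule ℚ (K3Index → ℚ) :=
  k3FormRat.orthogonal (nsRat x)

/-- Membership in `trRat x`: orthogonality to every rational `(1,1)`-vector. [folklore] -/
theorem mem_trRat {x : K3Index → ℂ} {w : K3Index → ℚ} :
    w ∈ trRat x ↔ ∀ v ∈ nsRat x, k3FormRat v w = 0 := by
  simp [trRat, LinearMap.BilinForm.mem_orthogonal_iff]

/-- **The HK-Nikulin SECTOR.** `S` lies in the sector iff for some marking `(η, p, x)` of `S` (the six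
marking clauses of the K3 facts) the rational transcendental space `T_x = trRat x ≅ T(S)_ℚ` embeds
ISOMETRICALLY into the host `N_ℚ = (U³ ⊕ E₈(−2) ⊕ ⟨−2⟩)_ℚ` (a `ℚ`-linear `J`, isometric and injective
on `T_x`).  The marking clause `a ∪ b = k3Form(ηa, ηb) • p` pins the sign (no anti-isometric markings,
`not_antiIsometry_k3Form`), so the `∃ p` hides no `T(−1)`-branch.  This is the locus `L₂` of the card:
it contains Varesco's Nikulin locus `T_ℚ ↪ (U³ ⊕ E₈(−2))_ℚ` (rank `T ≤ 13`), every `T_ℚ` of rank `≤ 12`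
(indefinite complement of dimension `≥ 3`), and rank-`14` types such as
`T_d = ⟨−2d⟩ ⊕ U² ⊕ ⟨−2⟩ ⊕ E₈(−1)`; its ceiling is rank `14` (`= 23 − 9`). [cite: Mongardi2011, Thm. 5.2]
[cite: Varesco2023, Prop. 2.5] [cite: CamereEtAl2026, Thm. 1.1 and Cor. 5.10] -/
def InHKNikulinSector (S : SchemeOver ℂ) : Prop :=
  ∃ (η : complexBetti S (2 * 1) ≃ₗ[ℂ] (K3Index → ℂ)) (p : complexBetti S (2 * 2)) (x : K3Index → ℂ),
    MarkedK3[S, η, p, x] ∧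
    ∃ J : (K3Index → ℚ) →ₗ[ℚ] (HostIndex → ℚ),
      (∀ v ∈ trRat x, ∀ w ∈ trRat x, hostFormRat (J v) (J w) = k3FormRat v w) ∧
      (∀ v ∈ trRat x, J v = 0 → v = 0)

/-! ## Partial twin classes -/

/-- `Perp[S ; x]`: `x ∈ H²(S(ℂ); ℂ)` is TRANSCENDENTAL — cup-orthogonal to every divisor class
`d ∈ NS(S) ⊗ ℂ = algebraicClasses S 1 = N¹H²` (for a projective K3 surface: `x ∈ T(S)_ℚ ⊗ ℂ`), spelled
exactly as in the route items (`TwinTransportRMPicardTwo`). Local notation only.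
[cite: Huybrechts2016K3, Ch. 3 Def. 2.5] -/
local notation3 (prettyPrint := false) "Perp[" S " ; " x "]" =>
  ∀ d ∈ algebraicClasses S 1, cupProduct (rfl : 2 * 1 + 2 * 1 = 2 * 2) x d = 0

/-- **`γ` is a PARTIAL ALGEBRAIC TWIN CLASS from `S` to `Sg`** (`γ ∈ H⁴((Sg ⊗ S)(ℂ); ℂ)`, action
`Φ := [γ]_* : H²(S) → H²(Sg)`): (1) `Φ` is rational on rational classes; (2) `Φ` preserves every Hodge
type; (3) `Φ(T(S)) ⊆ T(Sg)`; (4) `T(Sg) ⊆ Φ(T(S))`; (5) `Φ` DOUBLES THE CUP FORM on `T(S)`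
(`(x.y) = a·p ⟹ (Φx.Φy) = 2a·pg`); here `T(·) = {x | Perp[· ; x]}` is the cup-orthogonal of the
divisor classes.  Nothing is asked on `NS(S)` — that freedom is what the completion stubs fill by
products of divisors.  The output of the hyperkähler Nikulin anchor is such a class
(`Φ = ν^* ∘ f ∘ θ`: Hilbert incidence, Markman's algebraic isometry, restriction to the fixed K3).
[cite: CamereEtAl2026, Thm. 5.12] [cite: Markman2024, Thm. 1.1] -/
def IsPartialTwinClass (μ : OrientationFamily) (S Sg : SchemeOver ℂ) (hS : IsK3Surface S)
    (hSg : IsK3Surface Sg) (p : complexBetti S (2 * 2)) (pg : complexBetti Sg (2 * 2))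
    (γ : complexBetti (MonoidalCategoryStruct.tensorObj Sg S) (2 * 2)) : Prop :=
  (∀ x, IsRationalClass x → IsRationalClass (Corr[μ, Sg, S, hSg, hS ; γ, x])) ∧
  (∀ (i j : ℕ) x, IsOfHodgeType 2 S (2 * 1) i j x →
      IsOfHodgeType 2 Sg (2 * 1) i j (Corr[μ, Sg, S, hSg, hS ; γ, x])) ∧
  (∀ x, Perp[S ; x] → Perp[Sg ; Corr[μ, Sg, S, hSg, hS ; γ, x]]) ∧
  (∀ y, Perp[Sg ; y] → ∃ x, Perp[S ; x] ∧ Corr[μ, Sg, S, hSg, hS ; γ, x] = y) ∧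
  (∀ x, Perp[S ; x] → ∀ y, Perp[S ; y] → ∀ a : ℂ,
      cupProduct (rfl : 2 * 1 + 2 * 1 = 2 * 2) x y = a • p →
        cupProduct (rfl : 2 * 1 + 2 * 1 = 2 * 2) (Corr[μ, Sg, S, hSg, hS ; γ, x])
          (Corr[μ, Sg, S, hSg, hS ; γ, y]) = ((2 : ℂ) * a) • pg)

end Summit.HodgeConjecture.HodgeConjecture.Theorems.NikulinTwinTransport

end
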